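import Summits.AnomalousDissipation.AnomalousDissipation.Theorems.SawtoothPulseCascadeK1LocalisedCascadeChirpWindowMass

/-!
# K1loc explicit start, phase 1: ONE-SIDED SHARP WINDOW MASSES OF THE TWO-TOOTH CHIRP («TwoToothAnnulusMass»)

Helper file of the prover lane on the crux `K1LocalisedCascade` (stmt-AnomalousDissipation-19491), route `SawtoothPulseCascade`
(arbiter A24-6 steps (3)–(5): the V/O junk `j_V + j_O` of `a₂`).  The termwise majorant of `…ChirpWindowMass.norm_fourierCoeff_twoTooth_le`,
`‖ĝ₀(m)‖ ≤ [m ≡ 2 (4)]·4λ/(π|λ²−m²|)` (`λ = 8|n|`), is summed SHARPLY over one-sided arithmetic windows using the partial fraction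
`4λ/(λ²−m²) = 2/(λ−m) + 2/(λ+m)`, the telescoping `1/x² ≤ ¼(1/(x−2) − 1/(x+2))` along `x ≡ 2 (4)` and Cauchy–Schwarz for the cross
term: `sum_window_maj_inside_pos_le`/`_neg_le` (`W ⊆ ±[4K₁+2, 4K₂−2]`, `4K₂ < λ`: `≤ (1/π²)(s_a + s_b)²` when `1/(λ−4K₂) − 1/(λ−4K₁) ≤ s_a²`,
`1/(λ+4K₁) − 1/(λ+4K₂) ≤ s_b²`), `sum_window_maj_outside_pos_le`/`_neg_le` (`λ < 4K₁`: `≤ (1/π²)(1/(4K₁−λ) − 1/(4K₂−λ))`),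
`twoTooth_maj_mono` (the majorant decreases in the lobe parameter on `|m| < 8c` — per-block constants) and the chirp versions
`sum_window_sq_norm_twoTooth_{inside,outside}_{pos,neg}_le`. No definitions; nothing about the crux.
[cite: Grafakos2014, Prop. 3.1.2 (5), Prop. 3.2.7 (3)] [problem: turb]
-/

-- `Summit.<Summit>.<Problem>`: single-conjunct summit, the duplicate namespace segment is deliberate.
set_option linter.dupNamespace false

noncomputable section

namespace Summit.AnomalousDissipation.AnomalousDissipation.Theorems.SawtoothPulseCascade.K1Window

open MeasureTheory Filter Topology UnitAddTorus Complex AddCircle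
open scoped Real
open Literature.Analysis Literature.Analysis.FunctionSpaces Literature.Analysis.FunctionSpaces.Torus Literature.Analysis.FluidPDE
open Literature.Analysis.FluidPDE.ShearStage
open Literature.Analysis.FluidPDE.SawtoothCascade Literature.Analysis.FluidPDE.SawtoothCascade.CascadeParams

/-! ## §1 Telescoping and Cauchy–Schwarz helpers -/

/-- **Telescoping over `c + 4k + 2`**: for `c + 4K₁ > 0` and `K₁ ≤ K₂`,
`Σ_{K₁ ≤ k < K₂} 1/(c+4k+2)² ≤ ¼(1/(c+4K₁) − 1/(c+4K₂))` (`1/x² ≤ ¼(1/(x−2) − 1/(x+2))`). [folklore] -/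
theorem sum_Ico_inv_sq_prog_le' (c : ℝ) {K₁ K₂ : ℕ} (hK : K₁ ≤ K₂) (hc : 0 < c + 4 * K₁) :
    ∑ k ∈ Finset.Ico K₁ K₂, 1 / (c + (4 * (k : ℝ) + 2)) ^ 2 ≤ 1 / 4 * (1 / (c + 4 * K₁) - 1 / (c + 4 * K₂)) := by
  induction K₂, hK using Nat.le_induction with
  | base => simp
  | succ K hKK ih =>
    rw [Finset.sum_Ico_succ_top hKK, Nat.cast_succ]
    have hK' : (K₁ : ℝ) ≤ K := by exact_mod_cast hKK
    have hx : 0 < c + 4 * K := by linarith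
    have hx1 : c + 4 * (K : ℝ) ≠ 0 := hx.ne'
    have hx2 : c + 4 * ((K : ℝ) + 1) ≠ 0 := (by linarith : 0 < c + 4 * ((K : ℝ) + 1)).ne'
    have e : 1 / 4 * (1 / (c + 4 * K) - 1 / (c + 4 * ((K : ℝ) + 1))) = 1 / ((c + 4 * K) * (c + 4 * ((K : ℝ) + 1))) := by
      field_simp
      ring
    have hstep : 1 / (c + (4 * (K : ℝ) + 2)) ^ 2 ≤ 1 / ((c + 4 * K) * (c + 4 * ((K : ℝ) + 1))) := by
      apply one_div_le_one_div_of_le (mul_pos hx (by linarith))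
      have : (c + (4 * (K : ℝ) + 2)) ^ 2 = (c + 4 * K) * (c + 4 * ((K : ℝ) + 1)) + 4 := by ring
      linarith
    rw [← e] at hstep
    linarith

/-- `Σ (u+v)² ≤ (s_u + s_v)²/4`-type step: if `Σ u² ≤ s_u²/4`, `Σ v² ≤ s_v²/4`, `s_u, s_v ≥ 0`, then
`Σ (u+v)² ≤ (s_u + s_v)²/4` (Cauchy–Schwarz on the cross term). [folklore] -/
theorem sum_add_sq_le_of_sq_le (s : Finset ℕ) (u v : ℕ → ℝ) {su sv : ℝ} (hsu : 0 ≤ su) (hsv : 0 ≤ sv)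
    (hu : ∑ k ∈ s, u k ^ 2 ≤ su ^ 2 / 4) (hv : ∑ k ∈ s, v k ^ 2 ≤ sv ^ 2 / 4) :
    ∑ k ∈ s, (u k + v k) ^ 2 ≤ (su + sv) ^ 2 / 4 := by
  have hcs := Finset.sum_mul_sq_le_sq_mul_sq s u v
  have h1 : (∑ k ∈ s, u k * v k) ^ 2 ≤ (su * sv / 4) ^ 2 := by
    refine hcs.trans ?_
    have h0u : 0 ≤ ∑ k ∈ s, u k ^ 2 := Finset.sum_nonneg fun _ _ => sq_nonneg _
    have h0v : 0 ≤ ∑ k ∈ s, v k ^ 2 := Finset.sum_nonneg fun _ _ => sq_nonneg _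
    calc (∑ k ∈ s, u k ^ 2) * ∑ k ∈ s, v k ^ 2 ≤ (su ^ 2 / 4) * (sv ^ 2 / 4) :=
          mul_le_mul hu hv h0v (by positivity)
      _ = (su * sv / 4) ^ 2 := by ring
  have h2 : ∑ k ∈ s, u k * v k ≤ su * sv / 4 :=
    (le_abs_self _).trans (abs_le_of_sq_le_sq h1 (by positivity))
  have e : ∑ k ∈ s, (u k + v k) ^ 2 = ∑ k ∈ s, u k ^ 2 + ∑ k ∈ s, v k ^ 2 + 2 * ∑ k ∈ s, u k * v k := by
    rw [Finset.mul_sum, ← Finset.sum_add_distrib, ← Finset.sum_add_distrib]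
    exact Finset.sum_congr rfl fun k _ => by ring
  rw [e]
  nlinarith

/-! ## §2 The two-tooth majorant summed over one-sided windows -/

/-- **INSIDE, positive side**: `λ > 0`, `K₁ ≤ K₂`, `4K₂ < λ`, `W ⊆ [4K₁+2, 4K₂−2]`, and `1/(λ−4K₂) − 1/(λ−4K₁) ≤ s_a²`,
`1/(λ+4K₁) − 1/(λ+4K₂) ≤ s_b²` (`s_a, s_b ≥ 0`): `Σ_{m∈W} [m ≡ 2 (4)]·(4λ/(π(λ²−m²)))² ≤ (1/π²)(s_a + s_b)²`. [folklore] -/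
theorem sum_window_maj_inside_pos_le {lam sa sb : ℝ} (hlam0 : 0 < lam) {K₁ K₂ : ℕ} (hK : K₁ ≤ K₂) (hK₂ : 4 * (K₂ : ℝ) < lam)
    (hsa : 0 ≤ sa) (hsb : 0 ≤ sb) (ha : 1 / (lam - 4 * K₂) - 1 / (lam - 4 * K₁) ≤ sa ^ 2)
    (hb : 1 / (lam + 4 * K₁) - 1 / (lam + 4 * K₂) ≤ sb ^ 2)
    (W : Finset ℤ) (hW : ∀ m ∈ W, 4 * (K₁ : ℤ) + 2 ≤ m ∧ m ≤ 4 * (K₂ : ℤ) - 2) :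
    ∑ m ∈ W, (if m % 4 = 2 then (4 * lam / (π * (lam ^ 2 - (m : ℝ) ^ 2))) ^ 2 else 0) ≤
      1 / π ^ 2 * (sa + sb) ^ 2 := by
  classical
  have hπ : 0 < π := Real.pi_pos
  set T : ℤ → ℝ := fun m => if m % 4 = 2 then (4 * lam / (π * (lam ^ 2 - (m : ℝ) ^ 2))) ^ 2 else 0 with hT
  have hT0 : ∀ m, 0 ≤ T m := fun m => by simp only [hT]; split_ifs <;> positivity
  -- restrict to the residue class, reindex by `m = 4k+2`
  set Pp : Finset ℤ := (Finset.Ico K₁ K₂).image fun k : ℕ => (4 * (k : ℤ) + 2) with hPp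
  have hsub : W.filter (fun m => m % 4 = 2) ⊆ Pp := by
    intro m hm
    rw [Finset.mem_filter] at hm
    obtain ⟨hmW, hres⟩ := hm
    obtain ⟨h1, h2⟩ := hW m hmW
    rw [hPp, Finset.mem_image]
    refine ⟨((m - 2) / 4).toNat, ?_, ?_⟩
    · rw [Finset.mem_Ico]; omega
    · omega
  have h1 : ∑ m ∈ W, T m = ∑ m ∈ W.filter (fun m => m % 4 = 2), T m :=
    (Finset.sum_subset (Finset.filter_subset _ W) (fun m hm hnot => by
      rw [Finset.mem_filter, not_and] at hnot
      simp [hT, hnot hm])).symm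
  have h2 : ∑ m ∈ W.filter (fun m => m % 4 = 2), T m ≤ ∑ m ∈ Pp, T m :=
    Finset.sum_le_sum_of_subset_of_nonneg hsub fun m _ _ => hT0 m
  have hinj : Set.InjOn (fun k : ℕ => (4 * (k : ℤ) + 2)) (Finset.Ico K₁ K₂ : Set ℕ) := fun a _ b _ h => by
    simpa using h
  -- the partial fraction on each progression term
  set u : ℕ → ℝ := fun k => 1 / (lam - (4 * (k : ℝ) + 2)) with hu
  set v : ℕ → ℝ := fun k => 1 / (lam + (4 * (k : ℝ) + 2)) with hv
  have hterm : ∀ k ∈ Finset.Ico K₁ K₂, T (4 * (k : ℤ) + 2) = (2 / π) ^ 2 * (u k + v k) ^ 2 := by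
    intro k hk
    have hk2 : (k : ℝ) + 1 ≤ K₂ := by exact_mod_cast (Finset.mem_Ico.1 hk).2
    have hm1 : 0 < lam - (4 * (k : ℝ) + 2) := by linarith
    have hm2 : 0 < lam + (4 * (k : ℝ) + 2) := by positivity
    have hres : (4 * (k : ℤ) + 2) % 4 = 2 := by omega
    simp only [hT, hu, hv, if_pos hres]
    have e : (((4 * (k : ℤ) + 2 : ℤ)) : ℝ) = 4 * (k : ℝ) + 2 := by push_cast; ring
    rw [e]
    have hd : lam ^ 2 - (4 * (k : ℝ) + 2) ^ 2 = (lam - (4 * (k : ℝ) + 2)) * (lam + (4 * (k : ℝ) + 2)) := by ring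
    rw [hd]
    have hne1 := hm1.ne'
    have hne2 := hm2.ne'
    have hπne := hπ.ne'
    rw [div_add_div _ _ hne1 hne2, div_pow, div_pow, div_pow, mul_pow]
    field_simp
    ring
  have h3 : ∑ m ∈ Pp, T m = (2 / π) ^ 2 * ∑ k ∈ Finset.Ico K₁ K₂, (u k + v k) ^ 2 := by
    rw [hPp, Finset.sum_image hinj, Finset.mul_sum]
    exact Finset.sum_congr rfl hterm
  -- the two telescoping sums
  have hU : ∑ k ∈ Finset.Ico K₁ K₂, u k ^ 2 ≤ sa ^ 2 / 4 := by
    have h := sum_Ico_inv_sq_prog_le lam hK hK₂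
    have e : ∀ k, u k ^ 2 = 1 / (lam - (4 * (k : ℝ) + 2)) ^ 2 := fun k => by simp only [hu]; rw [div_pow, one_pow]
    simp only [e]
    linarith
  have hV : ∑ k ∈ Finset.Ico K₁ K₂, v k ^ 2 ≤ sb ^ 2 / 4 := by
    have h := sum_Ico_inv_sq_prog_le' lam hK (by positivity)
    have e : ∀ k, v k ^ 2 = 1 / (lam + (4 * (k : ℝ) + 2)) ^ 2 := fun k => by simp only [hv]; rw [div_pow, one_pow]
    simp only [e]
    linarith
  have h4 := sum_add_sq_le_of_sq_le (Finset.Ico K₁ K₂) u v hsa hsb hU hV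
  have h0 : 0 ≤ (2 / π) ^ 2 := by positivity
  calc ∑ m ∈ W, T m = ∑ m ∈ W.filter (fun m => m % 4 = 2), T m := h1
    _ ≤ ∑ m ∈ Pp, T m := h2
    _ = (2 / π) ^ 2 * ∑ k ∈ Finset.Ico K₁ K₂, (u k + v k) ^ 2 := h3
    _ ≤ (2 / π) ^ 2 * ((sa + sb) ^ 2 / 4) := mul_le_mul_of_nonneg_left h4 h0
    _ = 1 / π ^ 2 * (sa + sb) ^ 2 := by ring

/-- The majorant is even in `m`: reflecting a window. [folklore] -/
theorem sum_window_maj_neg (lam : ℝ) (W : Finset ℤ) :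
    ∑ m ∈ W, (if m % 4 = 2 then (4 * lam / (π * (lam ^ 2 - (m : ℝ) ^ 2))) ^ 2 else 0) =
      ∑ m ∈ W.image (fun m => -m), (if m % 4 = 2 then (4 * lam / (π * (lam ^ 2 - (m : ℝ) ^ 2))) ^ 2 else 0) := by
  rw [Finset.sum_image (fun a _ b _ h => neg_inj.1 h)]
  refine Finset.sum_congr rfl fun m _ => ?_
  have hiff : (-m) % 4 = 2 ↔ m % 4 = 2 := by omega
  have e : ((-m : ℤ) : ℝ) ^ 2 = (m : ℝ) ^ 2 := by push_cast; ring
  simp only [hiff, e]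

/-- **INSIDE, negative side**: as `sum_window_maj_inside_pos_le` for `W ⊆ [−(4K₂−2), −(4K₁+2)]`. [folklore] -/
theorem sum_window_maj_inside_neg_le {lam sa sb : ℝ} (hlam0 : 0 < lam) {K₁ K₂ : ℕ} (hK : K₁ ≤ K₂) (hK₂ : 4 * (K₂ : ℝ) < lam)
    (hsa : 0 ≤ sa) (hsb : 0 ≤ sb) (ha : 1 / (lam - 4 * K₂) - 1 / (lam - 4 * K₁) ≤ sa ^ 2)
    (hb : 1 / (lam + 4 * K₁) - 1 / (lam + 4 * K₂) ≤ sb ^ 2)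
    (W : Finset ℤ) (hW : ∀ m ∈ W, 4 * (K₁ : ℤ) + 2 ≤ -m ∧ -m ≤ 4 * (K₂ : ℤ) - 2) :
    ∑ m ∈ W, (if m % 4 = 2 then (4 * lam / (π * (lam ^ 2 - (m : ℝ) ^ 2))) ^ 2 else 0) ≤
      1 / π ^ 2 * (sa + sb) ^ 2 := by
  rw [sum_window_maj_neg lam W]
  refine sum_window_maj_inside_pos_le hlam0 hK hK₂ hsa hsb ha hb _ fun m hm => ?_
  rw [Finset.mem_image] at hm
  obtain ⟨m', hm', rfl⟩ := hm
  exact hW m' hm'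

/-- **OUTSIDE, positive side**: `0 < λ < 4K₁`, `K₁ ≤ K₂`, `W ⊆ [4K₁+2, 4K₂−2]`:
`Σ_{m∈W} [m ≡ 2 (4)]·(4λ/(π(λ²−m²)))² ≤ (1/π²)(1/(4K₁−λ) − 1/(4K₂−λ))` (`4λ/(m²−λ²) = 2/(m−λ) − 2/(m+λ) ≤ 2/(m−λ)`). [folklore] -/
theorem sum_window_maj_outside_pos_le {lam : ℝ} (hlam0 : 0 < lam) {K₁ K₂ : ℕ} (hK : K₁ ≤ K₂) (hK₁ : lam < 4 * (K₁ : ℝ))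
    (W : Finset ℤ) (hW : ∀ m ∈ W, 4 * (K₁ : ℤ) + 2 ≤ m ∧ m ≤ 4 * (K₂ : ℤ) - 2) :
    ∑ m ∈ W, (if m % 4 = 2 then (4 * lam / (π * (lam ^ 2 - (m : ℝ) ^ 2))) ^ 2 else 0) ≤
      1 / π ^ 2 * (1 / (4 * K₁ - lam) - 1 / (4 * K₂ - lam)) := by
  classical
  have hπ : 0 < π := Real.pi_pos
  set T : ℤ → ℝ := fun m => if m % 4 = 2 then (4 * lam / (π * (lam ^ 2 - (m : ℝ) ^ 2))) ^ 2 else 0 with hT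
  have hT0 : ∀ m, 0 ≤ T m := fun m => by simp only [hT]; split_ifs <;> positivity
  set Pp : Finset ℤ := (Finset.Ico K₁ K₂).image fun k : ℕ => (4 * (k : ℤ) + 2) with hPp
  have hsub : W.filter (fun m => m % 4 = 2) ⊆ Pp := by
    intro m hm
    rw [Finset.mem_filter] at hm
    obtain ⟨hmW, hres⟩ := hm
    obtain ⟨h1, h2⟩ := hW m hmW
    rw [hPp, Finset.mem_image]
    refine ⟨((m - 2) / 4).toNat, ?_, ?_⟩
    · rw [Finset.mem_Ico]; omega
    · omega
  have h1 : ∑ m ∈ W, T m = ∑ m ∈ W.filter (fun m => m % 4 = 2), T m :=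
    (Finset.sum_subset (Finset.filter_subset _ W) (fun m hm hnot => by
      rw [Finset.mem_filter, not_and] at hnot
      simp [hT, hnot hm])).symm
  have h2 : ∑ m ∈ W.filter (fun m => m % 4 = 2), T m ≤ ∑ m ∈ Pp, T m :=
    Finset.sum_le_sum_of_subset_of_nonneg hsub fun m _ _ => hT0 m
  have hinj : Set.InjOn (fun k : ℕ => (4 * (k : ℤ) + 2)) (Finset.Ico K₁ K₂ : Set ℕ) := fun a _ b _ h => by
    simpa using h
  -- termwise: `(4λ/(π(λ²−m²)))² ≤ (2/π)²/(m−λ)²` for `m = 4k+2 > λ`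
  have hterm : ∀ k ∈ Finset.Ico K₁ K₂, T (4 * (k : ℤ) + 2) ≤ (2 / π) ^ 2 * (1 / (-lam + (4 * (k : ℝ) + 2)) ^ 2) := by
    intro k hk
    have hk1 : (K₁ : ℝ) ≤ k := by exact_mod_cast (Finset.mem_Ico.1 hk).1
    have hm1 : 0 < (4 * (k : ℝ) + 2) - lam := by linarith
    have hm2 : 0 < (4 * (k : ℝ) + 2) + lam := by positivity
    have hres : (4 * (k : ℤ) + 2) % 4 = 2 := by omega
    simp only [hT, if_pos hres]
    have e : (((4 * (k : ℤ) + 2 : ℤ)) : ℝ) = 4 * (k : ℝ) + 2 := by push_cast; ring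
    rw [e]
    -- `|4λ/(π(λ²−m²))| = 4λ/(π(m²−λ²)) ≤ (2/π)/(m−λ)`
    have hd : (4 * (k : ℝ) + 2) ^ 2 - lam ^ 2 = ((4 * (k : ℝ) + 2) - lam) * ((4 * (k : ℝ) + 2) + lam) := by ring
    have hdpos : 0 < (4 * (k : ℝ) + 2) ^ 2 - lam ^ 2 := by rw [hd]; positivity
    have habs : |4 * lam / (π * (lam ^ 2 - (4 * (k : ℝ) + 2) ^ 2))| = 4 * lam / (π * ((4 * (k : ℝ) + 2) ^ 2 - lam ^ 2)) := by
      rw [show lam ^ 2 - (4 * (k : ℝ) + 2) ^ 2 = -((4 * (k : ℝ) + 2) ^ 2 - lam ^ 2) by ring, mul_neg, div_neg, abs_neg,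
        abs_of_pos (by positivity)]
    have hle : 4 * lam / (π * ((4 * (k : ℝ) + 2) ^ 2 - lam ^ 2)) ≤ 2 / π * (1 / (-lam + (4 * (k : ℝ) + 2))) := by
      rw [hd, show -lam + (4 * (k : ℝ) + 2) = (4 * (k : ℝ) + 2) - lam by ring]
      have e2 : 2 / π * (1 / ((4 * (k : ℝ) + 2) - lam)) =
          2 * ((4 * (k : ℝ) + 2) + lam) / (π * (((4 * (k : ℝ) + 2) - lam) * ((4 * (k : ℝ) + 2) + lam))) := by
        rw [div_mul_div_comm, div_eq_div_iff (by positivity) (by positivity)]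
        ring
      rw [e2]
      exact div_le_div_of_nonneg_right (by linarith) (by positivity)
    have h0 : 0 ≤ 4 * lam / (π * ((4 * (k : ℝ) + 2) ^ 2 - lam ^ 2)) := by positivity
    calc (4 * lam / (π * (lam ^ 2 - (4 * (k : ℝ) + 2) ^ 2))) ^ 2
        = |4 * lam / (π * (lam ^ 2 - (4 * (k : ℝ) + 2) ^ 2))| ^ 2 := (sq_abs _).symm
      _ = (4 * lam / (π * ((4 * (k : ℝ) + 2) ^ 2 - lam ^ 2))) ^ 2 := by rw [habs]
      _ ≤ (2 / π * (1 / (-lam + (4 * (k : ℝ) + 2)))) ^ 2 := pow_le_pow_left₀ h0 hle 2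
      _ = (2 / π) ^ 2 * (1 / (-lam + (4 * (k : ℝ) + 2)) ^ 2) := by rw [mul_pow, one_div_pow]
  have h3 : ∑ m ∈ Pp, T m ≤ (2 / π) ^ 2 * ∑ k ∈ Finset.Ico K₁ K₂, 1 / (-lam + (4 * (k : ℝ) + 2)) ^ 2 := by
    rw [hPp, Finset.sum_image hinj, Finset.mul_sum]
    exact Finset.sum_le_sum fun k hk => hterm k hk
  have h4 := sum_Ico_inv_sq_prog_le' (-lam) hK (by linarith)
  have h0 : 0 ≤ (2 / π) ^ 2 := by positivity
  calc ∑ m ∈ W, T m = ∑ m ∈ W.filter (fun m => m % 4 = 2), T m := h1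
    _ ≤ ∑ m ∈ Pp, T m := h2
    _ ≤ (2 / π) ^ 2 * ∑ k ∈ Finset.Ico K₁ K₂, 1 / (-lam + (4 * (k : ℝ) + 2)) ^ 2 := h3
    _ ≤ (2 / π) ^ 2 * (1 / 4 * (1 / (-lam + 4 * K₁) - 1 / (-lam + 4 * K₂))) := mul_le_mul_of_nonneg_left h4 h0
    _ = 1 / π ^ 2 * (1 / (4 * K₁ - lam) - 1 / (4 * K₂ - lam)) := by
        rw [show -lam + 4 * (K₁ : ℝ) = 4 * K₁ - lam by ring, show -lam + 4 * (K₂ : ℝ) = 4 * K₂ - lam by ring]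
        ring

/-- **OUTSIDE, negative side**: as `sum_window_maj_outside_pos_le` for `W ⊆ [−(4K₂−2), −(4K₁+2)]`. [folklore] -/
theorem sum_window_maj_outside_neg_le {lam : ℝ} (hlam0 : 0 < lam) {K₁ K₂ : ℕ} (hK : K₁ ≤ K₂) (hK₁ : lam < 4 * (K₁ : ℝ))
    (W : Finset ℤ) (hW : ∀ m ∈ W, 4 * (K₁ : ℤ) + 2 ≤ -m ∧ -m ≤ 4 * (K₂ : ℤ) - 2) :
    ∑ m ∈ W, (if m % 4 = 2 then (4 * lam / (π * (lam ^ 2 - (m : ℝ) ^ 2))) ^ 2 else 0) ≤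
      1 / π ^ 2 * (1 / (4 * K₁ - lam) - 1 / (4 * K₂ - lam)) := by
  rw [sum_window_maj_neg lam W]
  refine sum_window_maj_outside_pos_le hlam0 hK hK₁ _ fun m hm => ?_
  rw [Finset.mem_image] at hm
  obtain ⟨m', hm', rfl⟩ := hm
  exact hW m' hm'

/-! ## §3 The exact two-tooth chirp: termwise majorant with a lobe parameter `c ≤ |n|` -/

/-- **Monotonicity of the majorant in the lobe**: for `0 < c ≤ c'` and `|m| < 8c`,
`32c'/(π|64c'²−m²|) ≤ 4(8c)/(π((8c)²−m²))`. [folklore] -/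
theorem twoTooth_maj_mono {c c' m : ℝ} (hc : 0 < c) (hcc : c ≤ c') (hm : |m| < 8 * c) :
    32 * c' / (π * |64 * c' ^ 2 - m ^ 2|) ≤ 4 * (8 * c) / (π * ((8 * c) ^ 2 - m ^ 2)) := by
  have hπ : 0 < π := Real.pi_pos
  have hm2 : m ^ 2 < (8 * c) ^ 2 := by
    have := abs_lt.1 hm
    nlinarith [sq_abs m, abs_nonneg m]
  have hd : 0 < (8 * c) ^ 2 - m ^ 2 := by linarith
  have hd' : 0 < 64 * c' ^ 2 - m ^ 2 := by nlinarith
  rw [abs_of_pos hd', div_le_div_iff₀ (mul_pos hπ hd') (mul_pos hπ hd)]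
  -- `32c'·π((8c)²−m²) ≤ 32c·π(64c'²−m²)` ⇔ `c'(64c²−m²) ≤ c(64c'²−m²)` ⇔ `(c'−c)(64cc' + m²) ≥ 0`
  have key : c' * (64 * c ^ 2 - m ^ 2) ≤ c * (64 * c' ^ 2 - m ^ 2) := by
    have hc' : 0 ≤ c' := hc.le.trans hcc
    have h1 : 0 ≤ (c' - c) * (64 * c * c' + m ^ 2) :=
      mul_nonneg (by linarith) (add_nonneg (mul_nonneg (mul_nonneg (by norm_num) hc.le) hc') (sq_nonneg _))
    nlinarith
  have e1 : 32 * c' * (π * ((8 * c) ^ 2 - m ^ 2)) = 32 * π * (c' * (64 * c ^ 2 - m ^ 2)) := by ring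
  have e2 : 4 * (8 * c) * (π * (64 * c' ^ 2 - m ^ 2)) = 32 * π * (c * (64 * c' ^ 2 - m ^ 2)) := by ring
  rw [e1, e2]
  exact mul_le_mul_of_nonneg_left key (by positivity)

/-- **Termwise, with a lobe parameter**: the exact two-tooth chirp of lobe `8n`, `0 < c ≤ |n|`, `|m| < 8c`:
`‖ĝ₀(m)‖² ≤ [m ≡ 2 (4)]·(4λ/(π(λ²−m²)))²` with `λ = 8c`. [cite: Grafakos2014, Prop. 3.1.2 (5)] -/
theorem sq_norm_fourierCoeff_twoTooth_le_maj (n : ℤ) {g₀ : UnitAddCircle → ℂ}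
    (hg₀ : ∀ t : ℝ, g₀ (t : UnitAddCircle) =
      Complex.exp (-(2 * π * I * ((8 * n : ℤ)) * ((tri (2 * π * (2 : ℕ) * t) / (2 * π * (2 : ℕ)) : ℝ) : ℂ))))
    {c : ℝ} (hc : 0 < c) (hcn : c ≤ |(n : ℝ)|) {m : ℤ} (hm : |(m : ℝ)| < 8 * c) :
    ‖fourierCoeff g₀ m‖ ^ 2 ≤ (if m % 4 = 2 then (4 * (8 * c) / (π * ((8 * c) ^ 2 - (m : ℝ) ^ 2))) ^ 2 else 0) := by
  have hπ : 0 < π := Real.pi_pos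
  have hmn : |(m : ℝ)| < 8 * |(n : ℝ)| := by linarith
  have hm₁ : 8 * n + m ≠ 0 := by
    intro h
    have : (m : ℝ) = -(8 * n) := by exact_mod_cast (by linarith : m = -(8 * n))
    rw [this, abs_neg, abs_mul, abs_of_pos (by norm_num : (0:ℝ) < 8)] at hmn
    linarith
  have hm₂ : 8 * n - m ≠ 0 := by
    intro h
    have : (m : ℝ) = 8 * n := by exact_mod_cast (by linarith : m = 8 * n)
    rw [this, abs_mul, abs_of_pos (by norm_num : (0:ℝ) < 8)] at hmn
    linarith
  have h := norm_fourierCoeff_twoTooth_le n hg₀ hm₁ hm₂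
  have hn2 : (n : ℝ) ^ 2 = |(n : ℝ)| ^ 2 := (sq_abs _).symm
  rw [hn2] at h
  split_ifs with hres
  · rw [if_pos hres] at h
    have h' := h.trans (twoTooth_maj_mono hc hcn hm)
    exact pow_le_pow_left₀ (norm_nonneg _) h' 2
  · rw [if_neg hres] at h
    have : ‖fourierCoeff g₀ m‖ = 0 := le_antisymm h (norm_nonneg _)
    rw [this]; norm_num

/-- **INSIDE, positive side, for the chirp**: `0 < c ≤ |n|`, `λ = 8c`, `4K₂ < λ`, `W ⊆ [4K₁+2, 4K₂−2]`, slack bounds `s_a, s_b`: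
`Σ_{m∈W} ‖ĝ₀(m)‖² ≤ (1/π²)(s_a + s_b)²`. [cite: Grafakos2014, Prop. 3.1.2 (5), Prop. 3.2.7 (3)] -/
theorem sum_window_sq_norm_twoTooth_inside_pos_le (n : ℤ) {g₀ : UnitAddCircle → ℂ}
    (hg₀ : ∀ t : ℝ, g₀ (t : UnitAddCircle) =
      Complex.exp (-(2 * π * I * ((8 * n : ℤ)) * ((tri (2 * π * (2 : ℕ) * t) / (2 * π * (2 : ℕ)) : ℝ) : ℂ))))
    {c sa sb : ℝ} (hc : 0 < c) (hcn : c ≤ |(n : ℝ)|) {K₁ K₂ : ℕ} (hK : K₁ ≤ K₂) (hK₂ : 4 * (K₂ : ℝ) < 8 * c)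
    (hsa : 0 ≤ sa) (hsb : 0 ≤ sb) (ha : 1 / (8 * c - 4 * K₂) - 1 / (8 * c - 4 * K₁) ≤ sa ^ 2)
    (hb : 1 / (8 * c + 4 * K₁) - 1 / (8 * c + 4 * K₂) ≤ sb ^ 2)
    (W : Finset ℤ) (hW : ∀ m ∈ W, 4 * (K₁ : ℤ) + 2 ≤ m ∧ m ≤ 4 * (K₂ : ℤ) - 2) :
    ∑ m ∈ W, ‖fourierCoeff g₀ m‖ ^ 2 ≤ 1 / π ^ 2 * (sa + sb) ^ 2 := by
  refine le_trans (Finset.sum_le_sum fun m hm => sq_norm_fourierCoeff_twoTooth_le_maj n hg₀ hc hcn ?_)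
    (sum_window_maj_inside_pos_le (by positivity) hK hK₂ hsa hsb ha hb W hW)
  have h2' : (m : ℝ) ≤ 4 * K₂ - 2 := by exact_mod_cast (hW m hm).2
  have h1' : (4 * K₁ + 2 : ℝ) ≤ m := by exact_mod_cast (hW m hm).1
  rw [abs_of_nonneg (by linarith [(by positivity : (0:ℝ) ≤ 4 * K₁)])]; linarith

/-- **INSIDE, negative side, for the chirp**. [cite: Grafakos2014, Prop. 3.1.2 (5), Prop. 3.2.7 (3)] -/
theorem sum_window_sq_norm_twoTooth_inside_neg_le (n : ℤ) {g₀ : UnitAddCircle → ℂ}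
    (hg₀ : ∀ t : ℝ, g₀ (t : UnitAddCircle) =
      Complex.exp (-(2 * π * I * ((8 * n : ℤ)) * ((tri (2 * π * (2 : ℕ) * t) / (2 * π * (2 : ℕ)) : ℝ) : ℂ))))
    {c sa sb : ℝ} (hc : 0 < c) (hcn : c ≤ |(n : ℝ)|) {K₁ K₂ : ℕ} (hK : K₁ ≤ K₂) (hK₂ : 4 * (K₂ : ℝ) < 8 * c)
    (hsa : 0 ≤ sa) (hsb : 0 ≤ sb) (ha : 1 / (8 * c - 4 * K₂) - 1 / (8 * c - 4 * K₁) ≤ sa ^ 2)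
    (hb : 1 / (8 * c + 4 * K₁) - 1 / (8 * c + 4 * K₂) ≤ sb ^ 2)
    (W : Finset ℤ) (hW : ∀ m ∈ W, 4 * (K₁ : ℤ) + 2 ≤ -m ∧ -m ≤ 4 * (K₂ : ℤ) - 2) :
    ∑ m ∈ W, ‖fourierCoeff g₀ m‖ ^ 2 ≤ 1 / π ^ 2 * (sa + sb) ^ 2 := by
  refine le_trans (Finset.sum_le_sum fun m hm => sq_norm_fourierCoeff_twoTooth_le_maj n hg₀ hc hcn ?_)
    (sum_window_maj_inside_neg_le (by positivity) hK hK₂ hsa hsb ha hb W hW)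
  have h2' : (-m : ℝ) ≤ 4 * K₂ - 2 := by exact_mod_cast (hW m hm).2
  have h1' : (4 * K₁ + 2 : ℝ) ≤ -m := by exact_mod_cast (hW m hm).1
  rw [abs_of_nonpos (by linarith [(by positivity : (0:ℝ) ≤ 4 * K₁)])]; linarith

/-- **Termwise beyond the lobes** (`λ = 8|n|`, `|m| > λ`): `‖ĝ₀(m)‖² ≤ [m ≡ 2 (4)]·(4λ/(π(λ²−m²)))²`
(the square removes the sign of `λ² − m²`). [cite: Grafakos2014, Prop. 3.1.2 (5)] -/
theorem sq_norm_fourierCoeff_twoTooth_le_maj_out (n : ℤ) {g₀ : UnitAddCircle → ℂ}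
    (hg₀ : ∀ t : ℝ, g₀ (t : UnitAddCircle) =
      Complex.exp (-(2 * π * I * ((8 * n : ℤ)) * ((tri (2 * π * (2 : ℕ) * t) / (2 * π * (2 : ℕ)) : ℝ) : ℂ))))
    {m : ℤ} (hm : 8 * |(n : ℝ)| < |(m : ℝ)|) :
    ‖fourierCoeff g₀ m‖ ^ 2 ≤
      (if m % 4 = 2 then (4 * (8 * |(n : ℝ)|) / (π * ((8 * |(n : ℝ)|) ^ 2 - (m : ℝ) ^ 2))) ^ 2 else 0) := by
  have hπ : 0 < π := Real.pi_pos
  have h8 : |((8 * n : ℤ) : ℝ)| = 8 * |(n : ℝ)| := by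
    push_cast; rw [abs_mul, abs_of_pos (by norm_num : (0:ℝ) < 8)]
  have hm₁ : 8 * n + m ≠ 0 := by
    intro h
    have e : (m : ℝ) = -(((8 * n : ℤ)) : ℝ) := by exact_mod_cast (by linarith : m = -(8 * n))
    rw [e, abs_neg, h8] at hm
    exact lt_irrefl _ hm
  have hm₂ : 8 * n - m ≠ 0 := by
    intro h
    have e : (m : ℝ) = (((8 * n : ℤ)) : ℝ) := by exact_mod_cast (by linarith : m = 8 * n)
    rw [e, h8] at hm
    exact lt_irrefl _ hm
  have h := norm_fourierCoeff_twoTooth_le n hg₀ hm₁ hm₂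
  split_ifs with hres
  · rw [if_pos hres] at h
    refine (pow_le_pow_left₀ (norm_nonneg _) h 2).trans (le_of_eq ?_)
    simp only [div_pow, mul_pow, sq_abs]
    ring
  · rw [if_neg hres] at h
    have : ‖fourierCoeff g₀ m‖ = 0 := le_antisymm h (norm_nonneg _)
    rw [this]; norm_num

/-- **OUTSIDE, positive side, for the chirp** (`λ = 8|n| < 4K₁`, `K₁ ≤ K₂`, `W ⊆ [4K₁+2, 4K₂−2]`):
`Σ_{m∈W} ‖ĝ₀(m)‖² ≤ (1/π²)(1/(4K₁−λ) − 1/(4K₂−λ))`. [cite: Grafakos2014, Prop. 3.1.2 (5), Prop. 3.2.7 (3)] -/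
theorem sum_window_sq_norm_twoTooth_outside_pos_le (n : ℤ) {g₀ : UnitAddCircle → ℂ}
    (hg₀ : ∀ t : ℝ, g₀ (t : UnitAddCircle) =
      Complex.exp (-(2 * π * I * ((8 * n : ℤ)) * ((tri (2 * π * (2 : ℕ) * t) / (2 * π * (2 : ℕ)) : ℝ) : ℂ))))
    (hn : n ≠ 0) {K₁ K₂ : ℕ} (hK : K₁ ≤ K₂) (hK₁ : 8 * |(n : ℝ)| < 4 * (K₁ : ℝ))
    (W : Finset ℤ) (hW : ∀ m ∈ W, 4 * (K₁ : ℤ) + 2 ≤ m ∧ m ≤ 4 * (K₂ : ℤ) - 2) :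
    ∑ m ∈ W, ‖fourierCoeff g₀ m‖ ^ 2 ≤ 1 / π ^ 2 * (1 / (4 * K₁ - 8 * |(n : ℝ)|) - 1 / (4 * K₂ - 8 * |(n : ℝ)|)) := by
  have hn' : 0 < |(n : ℝ)| := abs_pos.2 (Int.cast_ne_zero.2 hn)
  refine le_trans (Finset.sum_le_sum fun m hm => sq_norm_fourierCoeff_twoTooth_le_maj_out n hg₀ ?_)
    (sum_window_maj_outside_pos_le (by positivity) hK hK₁ W hW)
  have h1' : (4 * K₁ + 2 : ℝ) ≤ m := by exact_mod_cast (hW m hm).1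
  exact lt_of_lt_of_le (by linarith) (le_abs_self (m : ℝ))

/-- **OUTSIDE, negative side, for the chirp**. [cite: Grafakos2014, Prop. 3.1.2 (5), Prop. 3.2.7 (3)] -/
theorem sum_window_sq_norm_twoTooth_outside_neg_le (n : ℤ) {g₀ : UnitAddCircle → ℂ}
    (hg₀ : ∀ t : ℝ, g₀ (t : UnitAddCircle) =
      Complex.exp (-(2 * π * I * ((8 * n : ℤ)) * ((tri (2 * π * (2 : ℕ) * t) / (2 * π * (2 : ℕ)) : ℝ) : ℂ))))
    (hn : n ≠ 0) {K₁ K₂ : ℕ} (hK : K₁ ≤ K₂) (hK₁ : 8 * |(n : ℝ)| < 4 * (K₁ : ℝ))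
    (W : Finset ℤ) (hW : ∀ m ∈ W, 4 * (K₁ : ℤ) + 2 ≤ -m ∧ -m ≤ 4 * (K₂ : ℤ) - 2) :
    ∑ m ∈ W, ‖fourierCoeff g₀ m‖ ^ 2 ≤ 1 / π ^ 2 * (1 / (4 * K₁ - 8 * |(n : ℝ)|) - 1 / (4 * K₂ - 8 * |(n : ℝ)|)) := by
  have hn' : 0 < |(n : ℝ)| := abs_pos.2 (Int.cast_ne_zero.2 hn)
  refine le_trans (Finset.sum_le_sum fun m hm => sq_norm_fourierCoeff_twoTooth_le_maj_out n hg₀ ?_)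
    (sum_window_maj_outside_neg_le (by positivity) hK hK₁ W hW)
  have h1' : (4 * K₁ + 2 : ℝ) ≤ -m := by exact_mod_cast (hW m hm).1
  exact lt_of_lt_of_le (by linarith) (neg_le_abs (m : ℝ))

end Summit.AnomalousDissipation.AnomalousDissipation.Theorems.SawtoothPulseCascade.K1Window
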